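import Mathlib.Algebra.Field.Subfield.Basic
import Mathlib.Data.Nat.Prime.Int
import Mathlib.NumberTheory.NumberField.Basic
import Mathlib.RingTheory.DedekindDomain.SInteger
import Mathlib.RingTheory.Ideal.GoingUp
import HarnessLib

/-!
# [AbsTopIII] §5, Remark 5.10.2 (iv) (p. 153): additively closed subgroups of `F^×`

S. Mochizuki, *Topics in Absolute Anabelian Geometry III*, §5, Remark 5.10.2 (iv), kurims
manuscript p. 153 (lit key `paper:url-5493eb38cbb7`; journal pagination not held)
[cite: MochizukiAbsTopIII2015, Rmk 5.10.2 (iv) p.153]: "to work with line bundles in a fashion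
that allows one to ignore some nonempty set of primes of the number field amounts to working with
a notion of rational equivalence that involves some proper subgroup of the multiplicative group
`F^×` … On the other [hand], the only subgroups of `F^×` that [if one considers the union of `F^×`
with `{0}`] are closed under addition are the subgroups of `F^×` that arise from subfields of `F`,
i.e., which correspond, in effect, to ⊞-line bundles as in Definition 5.3, (ii)."  Companion of
`AbsTopIII/RemarksLogShells.lean` (cell abc-iut, layer L4, block W2-B8, node
`AbsTopIII:Rmk5.10.2(iv)`), split off for the 400-line limit.

This sub-item is the one [IUTchII] (kurims p. 166) and [IUTchIII] Rmk. 3.6.2 (kurims p. 109) cite: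
"[the union with `{0}` of] `F^×_mod` admits a natural additive structure … this property is not
satisfied by … (b) subgroups `Γ ⊆ F^×_mod` — such as, for instance, the trivial subgroup `{1}` or
the subgroup of `S`-units, for `S ⊆ V_mod` a nonempty finite subset — that do not arise as the
multiplicative group of some subfield of `F_mod` [cf. [AbsTopIII], Remark 5.10.2, (iv)]".

## What is typed, and how (everything here is PROVED; no named facts)

* `withZero Γ = Γ ∪ {0} ⊆ F` and `AddClosed Γ` ("closed under addition") for `Γ : Subgroup Fˣ`.
* `natCast_mem_of_addClosed`: in characteristic `0` an additively closed `Γ ∪ {0}` contains every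
  positive integer — the engine of the two [IUTchIII] instances, which are then proved outright:
  `Rmk_5_10_2_iv_bot` (`Γ = {1}`) and `Rmk_5_10_2_iv_SUnits` (`Γ = 𝒪_{F,S}^×`, Mathlib's
  `Set.unit`, for ANY finite set `S` of finite places of a number field, in particular a nonempty
  one as printed).
* `Rmk_5_10_2_iv`: the printed biconditional in the reading "`Γ ∪ {0}` is closed under addition
  and additive inverses" ⟺ "`Γ ∪ {0}` is (the underlying set of) a subfield of `F`".
* READING NOTE, kernel-checked (`Rmk_5_10_2_iv_literal_witness`): under the literal reading
  "closed under addition" alone the "only" direction fails already for `F = ℚ` (`Γ = ℚ_{>0}`: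
  `ℚ_{≥0}` is additively closed, but `−1` lies in every subfield); the [IUTchIII] uses above do
  not go through that direction.  This is a precision note on an expository remark and takes no
  side on anything disputed.
-/

noncomputable section

open scoped Classical

namespace Literature.AnabelianGeometry.AbsoluteAnabelian.AbsTopIII

/-! ### Remark 5.10.2 (iv), p. 153 — `Γ ∪ {0}` and additive closure -/

section Rmk5102iv

variable {F : Type*} [Field F]

/-- "`Γ ∪ {0}`" for a subgroup `Γ ⊆ F^×` ("if one considers the union of `F^×` with `{0}`",
Rmk. 5.10.2 (iv) p. 153), as a subset of `F`. [cite: MochizukiAbsTopIII2015, Rmk 5.10.2 (iv) p.153] -/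
def withZero (Γ : Subgroup Fˣ) : Set F := insert 0 (Units.val '' (Γ : Set Fˣ))

/-- Membership in `Γ ∪ {0}`. [cite: MochizukiAbsTopIII2015, Rmk 5.10.2 (iv) p.153] -/
theorem mem_withZero {Γ : Subgroup Fˣ} {x : F} :
    x ∈ withZero Γ ↔ x = 0 ∨ ∃ γ : Fˣ, γ ∈ Γ ∧ (γ : F) = x := by
  simp [withZero]

/-- A unit lies in `Γ ∪ {0}` iff it lies in `Γ`. [cite: MochizukiAbsTopIII2015, Rmk 5.10.2 (iv) p.153] -/
theorem units_val_mem_withZero {Γ : Subgroup Fˣ} {γ : Fˣ} :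
    (γ : F) ∈ withZero Γ ↔ γ ∈ Γ := by
  rw [mem_withZero]
  refine ⟨?_, fun h => Or.inr ⟨γ, h, rfl⟩⟩
  rintro (h | ⟨γ', h', hγ'⟩)
  · exact (γ.ne_zero h).elim
  · rwa [← Units.val_injective hγ']

/-- "closed under addition" for `Γ ∪ {0}` (Rmk. 5.10.2 (iv) p. 153).
[cite: MochizukiAbsTopIII2015, Rmk 5.10.2 (iv) p.153] -/
def AddClosed (Γ : Subgroup Fˣ) : Prop :=
  ∀ a b : F, a ∈ withZero Γ → b ∈ withZero Γ → a + b ∈ withZero Γ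

/-- The engine of the uses of Rmk. 5.10.2 (iv) in [IUTchIII] Rmk. 3.6.2 p. 109, PROVED: in
characteristic `0`, if `Γ ∪ {0}` is closed under addition then every positive integer lies in
`Γ` (induction from `1 ∈ Γ`). [cite: MochizukiAbsTopIII2015, Rmk 5.10.2 (iv) p.153] -/
theorem natCast_mem_of_addClosed [CharZero F] {Γ : Subgroup Fˣ} (hΓ : AddClosed Γ) (n : ℕ)
    (hn : n ≠ 0) : ∃ γ : Fˣ, γ ∈ Γ ∧ (γ : F) = n := by
  have key : ∀ m : ℕ, ((m + 1 : ℕ) : F) ∈ withZero Γ := by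
    intro m
    induction m with
    | zero => simpa using (units_val_mem_withZero (γ := 1)).mpr Γ.one_mem
    | succ m ih =>
      have h := hΓ _ _ ih ((units_val_mem_withZero (γ := 1)).mpr Γ.one_mem)
      simpa [Nat.cast_succ] using h
  obtain ⟨m, rfl⟩ := Nat.exists_eq_succ_of_ne_zero hn
  rcases mem_withZero.mp (key m) with h | h
  · exact absurd h (by exact_mod_cast Nat.succ_ne_zero m)
  · exact h

/-- [IUTchIII] Rmk. 3.6.2 (b) "the trivial subgroup `{1}`" case, PROVED: in characteristic `0`
the trivial subgroup of `F^×` is not additively closed (`1 + 1 = 2 ∉ {0, 1}`).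
[cite: MochizukiAbsTopIII2015, Rmk 5.10.2 (iv) p.153] -/
theorem Rmk_5_10_2_iv_bot [CharZero F] : ¬ AddClosed (⊥ : Subgroup Fˣ) := by
  intro h
  obtain ⟨γ, hγ, hγ2⟩ := natCast_mem_of_addClosed h 2 two_ne_zero
  rw [Subgroup.mem_bot] at hγ
  rw [hγ, Units.val_one] at hγ2
  exact absurd hγ2 (by exact_mod_cast (show (1 : ℕ) ≠ 2 by decide))

/-- Remark 5.10.2 (iv), PROVED in the reading "`Γ ∪ {0}` is an additive subgroup" (closed under
addition AND additive inverses): such a `Γ` "arises from a subfield of `F`", i.e. `Γ ∪ {0}` is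
the underlying set of a subfield (it contains `0, 1`, and is closed under `+, −, ·, ⁻¹`);
conversely the unit group of a subfield is of this kind.  See `Rmk_5_10_2_iv_literal_witness`
for why the inverse-closure clause cannot be dropped. [cite: MochizukiAbsTopIII2015, Rmk 5.10.2 (iv) p.153] -/
theorem Rmk_5_10_2_iv (Γ : Subgroup Fˣ) :
    (AddClosed Γ ∧ ∀ a : F, a ∈ withZero Γ → -a ∈ withZero Γ) ↔
      ∃ L : Subfield F, (L : Set F) = withZero Γ := by
  constructor
  · rintro ⟨hadd, hneg⟩
    have hmul : ∀ a b : F, a ∈ withZero Γ → b ∈ withZero Γ → a * b ∈ withZero Γ := by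
      intro a b ha hb
      rcases mem_withZero.mp ha with rfl | ⟨α, hα, rfl⟩
      · simpa using (mem_withZero (Γ := Γ)).mpr (Or.inl rfl)
      rcases mem_withZero.mp hb with rfl | ⟨β, hβ, rfl⟩
      · simpa using (mem_withZero (Γ := Γ)).mpr (Or.inl rfl)
      rw [← Units.val_mul]
      exact units_val_mem_withZero.mpr (Γ.mul_mem hα hβ)
    have hinv : ∀ a : F, a ∈ withZero Γ → a⁻¹ ∈ withZero Γ := by
      intro a ha
      rcases mem_withZero.mp ha with rfl | ⟨α, hα, rfl⟩
      · simpa using (mem_withZero (Γ := Γ)).mpr (Or.inl rfl)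
      rw [← Units.val_inv_eq_inv_val]
      exact units_val_mem_withZero.mpr (Γ.inv_mem hα)
    let L : Subfield F :=
      { carrier := withZero Γ
        mul_mem' := fun {a b} ha hb => hmul a b ha hb
        one_mem' := by simpa using units_val_mem_withZero.mpr Γ.one_mem
        add_mem' := fun {a b} ha hb => hadd a b ha hb
        zero_mem' := mem_withZero.mpr (Or.inl rfl)
        neg_mem' := fun {a} ha => hneg a ha
        inv_mem' := fun a ha => hinv a ha }
    exact ⟨L, rfl⟩
  · rintro ⟨L, hL⟩
    refine ⟨fun a b ha hb => ?_, fun a ha => ?_⟩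
    · rw [← hL] at ha hb ⊢
      exact L.add_mem ha hb
    · rw [← hL] at ha ⊢
      exact L.neg_mem ha

/-- READING NOTE for Remark 5.10.2 (iv), kernel-checked: with "closed under addition" read
literally (no additive inverses), the subgroup `ℚ_{>0} ⊆ ℚ^×` of positive rationals has
`ℚ_{>0} ∪ {0}` closed under addition, yet it is not the set underlying any subfield of `ℚ`
(`−1` lies in every subfield).  The uses of (iv) in [IUTchIII] Rmk. 3.6.2 (`{1}`, `S`-units) do
not depend on this direction: see `Rmk_5_10_2_iv_bot`, `Rmk_5_10_2_iv_SUnits`.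
[cite: MochizukiAbsTopIII2015, Rmk 5.10.2 (iv) p.153] -/
theorem Rmk_5_10_2_iv_literal_witness :
    ∃ Γ : Subgroup ℚˣ, AddClosed Γ ∧ ¬ ∃ L : Subfield ℚ, (L : Set ℚ) = withZero Γ := by
  let Γ : Subgroup ℚˣ :=
    { carrier := {γ | 0 < (γ : ℚ)}
      mul_mem' := fun {a b} ha hb => by
        simp only [Set.mem_setOf_eq, Units.val_mul] at *; exact mul_pos ha hb
      one_mem' := by simp
      inv_mem' := fun {a} ha => by
        simp only [Set.mem_setOf_eq, Units.val_inv_eq_inv_val] at *; exact inv_pos.mpr ha }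
  have hmem : ∀ x : ℚ, x ∈ withZero Γ ↔ 0 ≤ x := by
    intro x
    rw [mem_withZero]
    constructor
    · rintro (rfl | ⟨γ, hγ, rfl⟩)
      · exact le_rfl
      · exact le_of_lt hγ
    · intro hx
      rcases hx.eq_or_lt with h | h
      · exact Or.inl h.symm
      · exact Or.inr ⟨Units.mk0 x h.ne', h, rfl⟩
  refine ⟨Γ, fun a b ha hb => (hmem _).mpr (add_nonneg ((hmem a).mp ha) ((hmem b).mp hb)), ?_⟩
  rintro ⟨L, hL⟩
  have h1 : (-1 : ℚ) ∈ withZero Γ := by rw [← hL]; exact L.neg_mem L.one_mem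
  have h2 := (hmem _).mp h1
  norm_num at h2

end Rmk5102iv

/-! ### Remark 5.10.2 (iv) as used in [IUTchIII] Rmk. 3.6.2: `S`-units are not additively closed -/

section SUnits

open NumberField IsDedekindDomain

variable (F : Type*) [Field F] [NumberField F]

/-- A number field has infinitely many finite places: above every rational prime there is a
prime of `𝓞 F` (`𝓞 F` is integral over `ℤ`), and primes above distinct rational primes are
distinct.  (Private helper; the same argument as the tree's
`AbelianVarietyRationalTorsionReduction.infinite_heightOneSpectrum`.)
[cite: MochizukiAbsTopIII2015, Rmk 5.10.2 (iv) p.153] -/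
private theorem exists_place_natPrime_mem :
    ∀ p : Nat.Primes, ∃ w : HeightOneSpectrum (𝓞 F), ((p : ℕ) : 𝓞 F) ∈ w.asIdeal := by
  intro p
  have hinj : Function.Injective (algebraMap ℤ (𝓞 F)) := (algebraMap ℤ (𝓞 F)).injective_int
  have hp : Prime (p : ℤ) := Nat.prime_iff_prime_int.mp p.2
  haveI : (Ideal.span {(p : ℤ)}).IsPrime := (Ideal.span_singleton_prime hp.ne_zero).mpr hp
  obtain ⟨Q, -, hQ, hQp⟩ := Ideal.exists_ideal_over_prime_of_isIntegral
    (S := 𝓞 F) (Ideal.span {(p : ℤ)}) ⊥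
    (by
      rw [← RingHom.ker_eq_comap_bot, (RingHom.injective_iff_ker_eq_bot _).mp hinj]
      exact bot_le)
  have hmem : (p : ℤ) ∈ Q.comap (algebraMap ℤ (𝓞 F)) := by
    rw [hQp]; exact Ideal.mem_span_singleton_self _
  refine ⟨⟨Q, hQ, fun hQbot => hp.ne_zero ?_⟩, ?_⟩
  · rw [hQbot, Ideal.mem_comap, Ideal.mem_bot, map_eq_zero_iff _ hinj] at hmem
    exact hmem
  · simpa [Ideal.mem_comap] using hmem

/-- [IUTchIII] Rmk. 3.6.2 (b) via [AbsTopIII] Rmk. 5.10.2 (iv), PROVED: for a number field `F`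
and a FINITE set `S` of finite places, the group of `S`-units `Γ = 𝒪_{F,S}^× ⊆ F^×` (Mathlib's
`Set.unit`: valuation `1` at every place outside `S`) is not additively closed — otherwise every
positive integer would be an `S`-unit (`natCast_mem_of_addClosed`), whereas a rational prime `p`
lying under a place `w ∉ S` has `w`-adic valuation `< 1`.
[cite: MochizukiAbsTopIII2015, Rmk 5.10.2 (iv) p.153] -/
theorem Rmk_5_10_2_iv_SUnits (S : Set (HeightOneSpectrum (𝓞 F))) (hS : S.Finite) :
    ¬ AddClosed (S.unit F) := by
  intro hadd
  choose w hw using exists_place_natPrime_mem F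
  -- `w` is injective: a place contains at most one rational prime.
  have hinj : Function.Injective w := by
    intro p q hpq
    by_contra hne
    have hcop : IsCoprime (p : ℤ) (q : ℤ) := by
      rw [Int.isCoprime_iff_gcd_eq_one, Int.gcd_natCast_natCast]
      exact (Nat.coprime_primes p.2 q.2).mpr fun h => hne (Subtype.ext h)
    obtain ⟨a, b, hab⟩ := hcop
    have h1 : (1 : 𝓞 F) ∈ (w p).asIdeal := by
      have := congrArg (fun z : ℤ => (z : 𝓞 F)) hab
      simp only [Int.cast_add, Int.cast_mul, Int.cast_natCast, Int.cast_one] at this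
      rw [← this]
      refine Ideal.add_mem _ (Ideal.mul_mem_left _ _ (hw p)) (Ideal.mul_mem_left _ _ ?_)
      rw [hpq]; exact hw q
    exact (w p).isPrime.ne_top ((Ideal.eq_top_iff_one _).mpr h1)
  -- a rational prime whose chosen place is outside the finite set `S`
  haveI : Infinite Nat.Primes := Nat.infinite_setOf_prime.to_subtype
  obtain ⟨p, hp⟩ : ∃ p : Nat.Primes, w p ∉ S := by
    by_contra h
    simp only [not_exists, not_not] at h
    exact ((Set.infinite_range_of_injective hinj).mono (Set.range_subset_iff.mpr h)) hS
  -- `p` would be an `S`-unit, but its `w p`-adic valuation is `< 1`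
  obtain ⟨γ, hγ, hγp⟩ := natCast_mem_of_addClosed hadd p p.2.ne_zero
  have hval : (w p).valuation F (γ : F) = 1 := hγ (w p) hp
  have hlt : (w p).valuation F (((p : ℕ) : 𝓞 F) : F) < 1 :=
    (HeightOneSpectrum.valuation_lt_one_iff_mem _ _).mpr (hw p)
  rw [hγp] at hval
  have : (((p : ℕ) : 𝓞 F) : F) = ((p : ℕ) : F) := by simp
  rw [this, hval] at hlt
  exact lt_irrefl _ hlt

end SUnits

end Literature.AnabelianGeometry.AbsoluteAnabelian.AbsTopIII
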